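import Summits.NavierStokesRegularity.NavierStokesRegularity.Theorems.OddMorawetzLocal.Negative.OddMorawetzLocalRefutationData5
import Summits.NavierStokesRegularity.NavierStokesRegularity.Theorems.OddMorawetzLocal.Negative.OddMorawetzLocalRefutationDefsV
import HarnessLib

/-!
# Crux `OddMorawetzLocal` (stmt-NavierStokesRegularity-1376) — kernel certificates, weight 5 (part E)

The finite computations of the weight-5 half of the refutation, each a closed Boolean evaluated by the kernel
(`decide +kernel`) on the vocabulary of `OddMorawetzLocalJetAlgebra` / `…RefutationDefs{,Fast,IV,V}` and the literal
data of `…RefutationData5` (197 orbit representatives `reps5`, 50 isotropic descriptors `isoDesc5`, three certificate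
blocks `blocks5` of sizes 53/45/49, the independence columns `kcols5` and inverse `cinv5`, prime 8191).
Part E: the kinds of the isotropic descriptors (`cert5_iso_kinds`: two live contraction densities, then divergences and ideal
members), canonicity of all their monomials (`cert5_iso_canonical_*`), and membership of the `ideal` elements in the
divergence-free differential ideal (`cert5_iso_ideal`).
No analysis; lands `--supports` the crux item; consumed by the weight-5 assembly of the refutation.
-/

set_option linter.dupNamespace false

namespace Summit.NavierStokesRegularity.NavierStokesRegularity.Theorems.OddMorawetz

/-- Descriptors `2 … 49` of the weight-5 isotropic basis are divergences (`null`) or ideal members (`ideal`); `0`, `1` are the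
two live contraction densities of shapes `(0,2,3)` and `(1,1,3)`. -/
theorem cert5_iso_kinds : ((isoDesc5.drop 2).all fun d => match d with
      | .null _ _ => true
      | .ideal _ _ => true
      | _ => false) = true ∧
    isoDesc5.take 2 = [.dens [0, 2, 3] [((0, 0), (2, 0)), ((1, 0), (2, 1)), ((1, 1), (2, 2)), ((1, 2), (2, 3))],
      .dens [1, 1, 3] [((0, 0), (2, 0)), ((0, 1), (2, 1)), ((1, 0), (2, 2)), ((1, 1), (2, 3))]] := by
  refine ⟨by decide +kernel, rfl⟩

/-- The `ideal` elements of the weight-5 isotropic basis lie in the divergence-free differential ideal. -/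
theorem cert5_iso_ideal :
    (isoDesc5.all fun d => match d with
      | .ideal sh m => nfKillsF (isoPolyF (.ideal sh m))
      | _ => true) = true := by
  decide +kernel

/-- All monomials of the isotropic basis polynomials `0 … 9` are canonical weight-5 basis monomials. -/
theorem cert5_iso_canonical_0 :
    (((isoDesc5.drop 0).take 10).all fun d => (isoPolyF d).all fun t =>
      decide (sortVars t.2 = t.2) && decide (t.2.length = 3) && decide (monoWeight t.2 = 5) &&
        t.2.all fun v => decide (sortIdx v.2 = v.2) && decide (v.2.length ≤ 3)) = true := by
  decide +kernel

/-- All monomials of the isotropic basis polynomials `10 … 19` are canonical weight-5 basis monomials. -/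
theorem cert5_iso_canonical_1 :
    (((isoDesc5.drop 10).take 10).all fun d => (isoPolyF d).all fun t =>
      decide (sortVars t.2 = t.2) && decide (t.2.length = 3) && decide (monoWeight t.2 = 5) &&
        t.2.all fun v => decide (sortIdx v.2 = v.2) && decide (v.2.length ≤ 3)) = true := by
  decide +kernel

/-- All monomials of the isotropic basis polynomials `20 … 29` are canonical weight-5 basis monomials. -/
theorem cert5_iso_canonical_2 :
    (((isoDesc5.drop 20).take 10).all fun d => (isoPolyF d).all fun t =>
      decide (sortVars t.2 = t.2) && decide (t.2.length = 3) && decide (monoWeight t.2 = 5) &&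
        t.2.all fun v => decide (sortIdx v.2 = v.2) && decide (v.2.length ≤ 3)) = true := by
  decide +kernel

/-- All monomials of the isotropic basis polynomials `30 … 39` are canonical weight-5 basis monomials. -/
theorem cert5_iso_canonical_3 :
    (((isoDesc5.drop 30).take 10).all fun d => (isoPolyF d).all fun t =>
      decide (sortVars t.2 = t.2) && decide (t.2.length = 3) && decide (monoWeight t.2 = 5) &&
        t.2.all fun v => decide (sortIdx v.2 = v.2) && decide (v.2.length ≤ 3)) = true := by
  decide +kernel

/-- All monomials of the isotropic basis polynomials `40 … 49` are canonical weight-5 basis monomials. -/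
theorem cert5_iso_canonical_4 :
    (((isoDesc5.drop 40).take 10).all fun d => (isoPolyF d).all fun t =>
      decide (sortVars t.2 = t.2) && decide (t.2.length = 3) && decide (monoWeight t.2 = 5) &&
        t.2.all fun v => decide (sortIdx v.2 = v.2) && decide (v.2.length ≤ 3)) = true := by
  decide +kernel

end Summit.NavierStokesRegularity.NavierStokesRegularity.Theorems.OddMorawetz
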